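import Mathlib
import Summits.Ventures.PercRepro2.Defs
import Summits.Ventures.PercRepro2.Harris
import Summits.Ventures.PercRepro2.Graph
import Summits.Ventures.PercRepro2.Events
import Summits.Ventures.PercRepro2.BHKAvoidWeighted
import Summits.Ventures.PercRepro2.PsiPendantLemmas
import Summits.Ventures.PercRepro2.PsiUniIsolated
import Summits.Ventures.PercRepro2.PsiPinInduction
import Summits.Ventures.PercRepro2.PsiUniSure

/-!
# The explored base of the `t`-exploration and the frame (Ψ) ⟸ (UNI_t) (PercRepro2, p2)

The `t`-exploration variant of the pin induction (P2-G17-PSI.md §6.2, §8.3) pins the edges at the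
explored `t`-cluster one by one.  The EXPLORED `t`-COMPONENT of a weight vector `p` is the set of
vertices reached from `t` along the pinned-open edges (`p e = 1`) — the connected component of `t`
in the configuration `fun e => decide (p e = 1)`.  When every edge at that component is pinned, the
cluster of `t` is deterministic: `{t ↔ x}` is sure for `x` in the component and null outside it
(every configuration of positive weight respects the pins).  So `Q = {s ↮ t}` and `{t ↔ o}` are
sure or null, and `PsiUniSure.lean` gives (UNI_f) for EVERY edge — the base of the induction.
Combined with `psi_slack_nonneg_of_uni`, this yields the kernel frame of the (PM⁺) line:
**(Ψ) holds for every instance as soon as every instance with an unpinned edge at its explored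
`t`-component has SOME such edge satisfying the one-edge property (UNI_f)** — the hypothesis is the
statement (UNI_t) of record (census-true on ≈ 150,000 pairs, two seats two codes), and only it.

* `conn_pinned_of_conn` — a configuration respecting the closed pins connects `t` only to the
  explored component;
* `pinned_le_of_respects` — a configuration respecting the open pins dominates the pinned-open one;
* `weight_eq_zero_of_breaks_pin`, `prob_eq_zero_of_forall_weight_eq_zero` — pins are a.s. respected;
* `prob_connEvent_eq_zero_of_explored`, `prob_connEvent_eq_one_of_explored` — `{t ↔ x}` is null
  outside and sure inside the explored component;
* `psi_uni_of_explored` — **(UNI_f) for every edge when every edge at the explored `t`-component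
  is pinned**;
* `psi_slack_nonneg_of_uni_t` — **the frame (Ψ) ⟸ (UNI_t)**.
-/

namespace Summit.Ventures.PercRepro2

section Explored

variable {V : Type*} {E : Type*} [Fintype E] [DecidableEq E] {R : Type*} [CommRing R]
  [LinearOrder R] [IsStrictOrderedRing R]

omit [Fintype E] [DecidableEq E] [IsStrictOrderedRing R] in
/-- If every edge at the explored `t`-component is pinned, a configuration respecting the closed
pins connects `t` only to vertices of the explored component. -/
lemma conn_pinned_of_conn {ends : E → Sym2 V} {p : E → R} {ω : Config E} {t x : V}
    (hpin : ∀ e, (∃ y ∈ ends e, Conn ends (fun e => decide (p e = 1)) t y) → p e = 0 ∨ p e = 1)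
    (h0 : ∀ e, p e = 0 → ω e = false) (h : Conn ends ω t x) :
    Conn ends (fun e => decide (p e = 1)) t x := by
  have hS : ∀ a ∈ {y | Conn ends (fun e => decide (p e = 1)) t y}, ∀ b,
      (openGraph ends ω).Adj a b → b ∈ {y | Conn ends (fun e => decide (p e = 1)) t y} := by
    intro a ha b hab
    simp only [Set.mem_setOf_eq] at ha ⊢
    obtain ⟨hne, e, he, hends⟩ := openGraph_adj.1 hab
    have hmem : a ∈ ends e := by rw [hends]; exact Sym2.mem_mk_left a b
    rcases hpin e ⟨a, hmem, ha⟩ with hpe | hpe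
    · rw [h0 e hpe] at he
      exact absurd he Bool.false_ne_true
    · have hadj : (openGraph ends (fun e => decide (p e = 1))).Adj a b :=
        openGraph_adj.2 ⟨hne, e, by simp [hpe], hends⟩
      exact conn_trans ha (SimpleGraph.Adj.reachable hadj)
  exact mem_of_conn_of_closed hS (conn_refl _ _ _) h

omit [Fintype E] [DecidableEq E] [IsStrictOrderedRing R] in
/-- A configuration respecting the open pins dominates the pinned-open configuration. -/
lemma pinned_le_of_respects {p : E → R} {ω : Config E} (h1 : ∀ e, p e = 1 → ω e = true) :
    (fun e => decide (p e = 1)) ≤ ω := by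
  intro e
  by_cases h : p e = 1
  · simp [h, h1 e h]
  · simp [h]

omit [LinearOrder R] [IsStrictOrderedRing R] in
/-- The weight vanishes on a configuration breaking a pin. -/
lemma weight_eq_zero_of_breaks_pin (p : E → R) (ω : Config E) {e : E}
    (h : (p e = 0 ∧ ω e = true) ∨ (p e = 1 ∧ ω e = false)) : weight p ω = 0 := by
  rw [weight_eq_mul_edgeFactor p ω e]
  rcases h with ⟨hpe, hωe⟩ | ⟨hpe, hωe⟩ <;> simp [hpe, hωe, edgeFactor]

omit [LinearOrder R] [IsStrictOrderedRing R] in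
/-- An event on which the weight vanishes is null. -/
lemma prob_eq_zero_of_forall_weight_eq_zero (p : E → R) {A : Set (Config E)}
    (h : ∀ ω ∈ A, weight p ω = 0) : prob p A = 0 := by
  unfold prob
  refine Finset.sum_eq_zero fun ω _ => ?_
  by_cases hA : ω ∈ A
  · rw [Set.indicator_of_mem hA]; exact h ω hA
  · rw [Set.indicator_of_notMem hA]

omit [IsStrictOrderedRing R] in
/-- If every edge at the explored `t`-component is pinned, `{t ↔ x}` is null for `x` outside it. -/
lemma prob_connEvent_eq_zero_of_explored (p : E → R) (ends : E → Sym2 V) {t x : V}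
    (hpin : ∀ e, (∃ y ∈ ends e, Conn ends (fun e => decide (p e = 1)) t y) → p e = 0 ∨ p e = 1)
    (hx : ¬ Conn ends (fun e => decide (p e = 1)) t x) : prob p (connEvent ends t x) = 0 := by
  refine prob_eq_zero_of_forall_weight_eq_zero p fun ω hω => ?_
  by_contra hne
  have h0 : ∀ e, p e = 0 → ω e = false := by
    intro e he
    by_contra hopen
    have hωe : ω e = true := by
      cases h : ω e
      · exact absurd h hopen
      · rfl
    exact hne (weight_eq_zero_of_breaks_pin p ω (Or.inl ⟨he, hωe⟩))
  exact hx (conn_pinned_of_conn hpin h0 hω)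

omit [IsStrictOrderedRing R] in
/-- `{t ↔ x}` is sure for `x` in the explored `t`-component. -/
lemma prob_connEvent_eq_one_of_explored (p : E → R) (ends : E → Sym2 V) {t x : V}
    (hx : Conn ends (fun e => decide (p e = 1)) t x) : prob p (connEvent ends t x) = 1 := by
  have hc : prob p (connEvent ends t x)ᶜ = 0 := by
    refine prob_eq_zero_of_forall_weight_eq_zero p fun ω hω => ?_
    by_contra hne
    have h1 : ∀ e, p e = 1 → ω e = true := by
      intro e he
      by_contra hclosed
      have hωe : ω e = false := by
        cases h : ω e
        · rfl
        · exact absurd h hclosed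
      exact hne (weight_eq_zero_of_breaks_pin p ω (Or.inr ⟨he, hωe⟩))
    exact hω (conn_mono (pinned_le_of_respects h1) hx)
  rw [prob_compl] at hc
  exact (sub_eq_zero.1 hc).symm

/-- **(UNI_f) for every edge when every edge at the explored `t`-component is pinned** — the base
of the `t`-exploration induction: the cluster of `t` is then deterministic, so `Q` and `{t ↔ o}`
are sure or null and `psi_uni_of_sure` applies. -/
theorem psi_uni_of_explored (p : E → R) (hp : IsProbVec p) (ends : E → Sym2 V) (s t o u : V)
    (hpin : ∀ e, (∃ y ∈ ends e, Conn ends (fun e => decide (p e = 1)) t y) → p e = 0 ∨ p e = 1)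
    (𝓤 : Set (Set V)) (f : E) :
    min (prob (Function.update p f 0) (clusterInEvent ends s 𝓤 ∩ (connEvent ends s t)ᶜ) *
        ((prob (Function.update p f 0) (connEvent ends s t)ᶜ - prob (Function.update p f 0) (connEvent ends s u ∩ (connEvent ends s t)ᶜ)) *
            prob (Function.update p f 0) (clusterInEvent ends t {W : Set V | o ∈ W} ∩ (connEvent ends s t)ᶜ) +
          prob (Function.update p f 0) (connEvent ends s t)ᶜ *
            (prob (Function.update p f 0) (connEvent ends s u ∩ clusterInEvent ends t {W : Set V | o ∈ W} ∩
          (connEvent ends s t)ᶜ) +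
              prob (Function.update p f 0) (connEvent ends s u ∩ clusterInEvent ends s {W : Set V | o ∈ W} ∩
          (connEvent ends s t)ᶜ)) -
          prob (Function.update p f 0) (connEvent ends s u ∩ (connEvent ends s t)ᶜ) *
            prob (Function.update p f 0) (clusterInEvent ends s {W : Set V | o ∈ W} ∩ (connEvent ends s t)ᶜ)) -
      prob (Function.update p f 0) (clusterInEvent ends s 𝓤 ∩ clusterInEvent ends t {W : Set V | o ∈ W} ∩
          (connEvent ends s t)ᶜ) * prob (Function.update p f 0) (connEvent ends s t)ᶜ * prob (Function.update p f 0) (connEvent ends s t)ᶜ) (prob (Function.update p f 1) (clusterInEvent ends s 𝓤 ∩ (connEvent ends s t)ᶜ) *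
        ((prob (Function.update p f 1) (connEvent ends s t)ᶜ - prob (Function.update p f 1) (connEvent ends s u ∩ (connEvent ends s t)ᶜ)) *
            prob (Function.update p f 1) (clusterInEvent ends t {W : Set V | o ∈ W} ∩ (connEvent ends s t)ᶜ) +
          prob (Function.update p f 1) (connEvent ends s t)ᶜ *
            (prob (Function.update p f 1) (connEvent ends s u ∩ clusterInEvent ends t {W : Set V | o ∈ W} ∩
          (connEvent ends s t)ᶜ) +
              prob (Function.update p f 1) (connEvent ends s u ∩ clusterInEvent ends s {W : Set V | o ∈ W} ∩
          (connEvent ends s t)ᶜ)) -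
          prob (Function.update p f 1) (connEvent ends s u ∩ (connEvent ends s t)ᶜ) *
            prob (Function.update p f 1) (clusterInEvent ends s {W : Set V | o ∈ W} ∩ (connEvent ends s t)ᶜ)) -
      prob (Function.update p f 1) (clusterInEvent ends s 𝓤 ∩ clusterInEvent ends t {W : Set V | o ∈ W} ∩
          (connEvent ends s t)ᶜ) * prob (Function.update p f 1) (connEvent ends s t)ᶜ * prob (Function.update p f 1) (connEvent ends s t)ᶜ) ≤ (prob p (clusterInEvent ends s 𝓤 ∩ (connEvent ends s t)ᶜ) *
        ((prob p (connEvent ends s t)ᶜ - prob p (connEvent ends s u ∩ (connEvent ends s t)ᶜ)) *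
            prob p (clusterInEvent ends t {W : Set V | o ∈ W} ∩ (connEvent ends s t)ᶜ) +
          prob p (connEvent ends s t)ᶜ *
            (prob p (connEvent ends s u ∩ clusterInEvent ends t {W : Set V | o ∈ W} ∩
          (connEvent ends s t)ᶜ) +
              prob p (connEvent ends s u ∩ clusterInEvent ends s {W : Set V | o ∈ W} ∩
          (connEvent ends s t)ᶜ)) -
          prob p (connEvent ends s u ∩ (connEvent ends s t)ᶜ) *
            prob p (clusterInEvent ends s {W : Set V | o ∈ W} ∩ (connEvent ends s t)ᶜ)) -
      prob p (clusterInEvent ends s 𝓤 ∩ clusterInEvent ends t {W : Set V | o ∈ W} ∩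
          (connEvent ends s t)ᶜ) * prob p (connEvent ends s t)ᶜ * prob p (connEvent ends s t)ᶜ) := by
  have hQ : prob p (connEvent ends s t) = 0 ∨ prob p (connEvent ends s t) = 1 := by
    rw [connEvent_comm]
    by_cases hs : Conn ends (fun e => decide (p e = 1)) t s
    · exact Or.inr (prob_connEvent_eq_one_of_explored p ends hs)
    · exact Or.inl (prob_connEvent_eq_zero_of_explored p ends hpin hs)
  have ho : prob p (connEvent ends t o) = 0 ∨ prob p (connEvent ends t o) = 1 := by
    by_cases hos : Conn ends (fun e => decide (p e = 1)) t o
    · exact Or.inr (prob_connEvent_eq_one_of_explored p ends hos)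
    · exact Or.inl (prob_connEvent_eq_zero_of_explored p ends hpin hos)
  exact psi_uni_of_sure p hp ends s t o u hQ ho 𝓤 f

end Explored

section Frame

variable {V : Type*} {E : Type*} [Fintype E] [DecidableEq E]
  {R : Type*} [CommRing R] [LinearOrder R] [IsStrictOrderedRing R]

/-- **The frame (Ψ) ⟸ (UNI_t).** If every admissible `p` with an unpinned edge at its explored
`t`-component (the component of `t` along the edges with `p e = 1`) has SOME unpinned edge `f` at
that component with `min(Σ_𝓤(p[f↦0]), Σ_𝓤(p[f↦1])) ≤ Σ_𝓤(p)`, then `0 ≤ Σ_𝓤(p)` — the (Ψ)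
inequality on the up-set `𝓤` — for every admissible `p`.  Instances with no unpinned edge at the
explored component are the base `psi_uni_of_explored`; the induction is `psi_slack_nonneg_of_uni`. -/
theorem psi_slack_nonneg_of_uni_t (ends : E → Sym2 V) (s t o u : V) (𝓤 : Set (Set V))
    (huni : ∀ p : E → R, IsProbVec p →
      (∃ e, (∃ y ∈ ends e, Conn ends (fun e => decide (p e = 1)) t y) ∧ p e ≠ 0 ∧ p e ≠ 1) →
      ∃ f, (∃ y ∈ ends f, Conn ends (fun e => decide (p e = 1)) t y) ∧ p f ≠ 0 ∧ p f ≠ 1 ∧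
        min (prob (Function.update p f 0) (clusterInEvent ends s 𝓤 ∩ (connEvent ends s t)ᶜ) *
        ((prob (Function.update p f 0) (connEvent ends s t)ᶜ - prob (Function.update p f 0) (connEvent ends s u ∩ (connEvent ends s t)ᶜ)) *
            prob (Function.update p f 0) (clusterInEvent ends t {W : Set V | o ∈ W} ∩ (connEvent ends s t)ᶜ) +
          prob (Function.update p f 0) (connEvent ends s t)ᶜ *
            (prob (Function.update p f 0) (connEvent ends s u ∩ clusterInEvent ends t {W : Set V | o ∈ W} ∩
          (connEvent ends s t)ᶜ) +
              prob (Function.update p f 0) (connEvent ends s u ∩ clusterInEvent ends s {W : Set V | o ∈ W} ∩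
          (connEvent ends s t)ᶜ)) -
          prob (Function.update p f 0) (connEvent ends s u ∩ (connEvent ends s t)ᶜ) *
            prob (Function.update p f 0) (clusterInEvent ends s {W : Set V | o ∈ W} ∩ (connEvent ends s t)ᶜ)) -
      prob (Function.update p f 0) (clusterInEvent ends s 𝓤 ∩ clusterInEvent ends t {W : Set V | o ∈ W} ∩
          (connEvent ends s t)ᶜ) * prob (Function.update p f 0) (connEvent ends s t)ᶜ * prob (Function.update p f 0) (connEvent ends s t)ᶜ) (prob (Function.update p f 1) (clusterInEvent ends s 𝓤 ∩ (connEvent ends s t)ᶜ) *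
        ((prob (Function.update p f 1) (connEvent ends s t)ᶜ - prob (Function.update p f 1) (connEvent ends s u ∩ (connEvent ends s t)ᶜ)) *
            prob (Function.update p f 1) (clusterInEvent ends t {W : Set V | o ∈ W} ∩ (connEvent ends s t)ᶜ) +
          prob (Function.update p f 1) (connEvent ends s t)ᶜ *
            (prob (Function.update p f 1) (connEvent ends s u ∩ clusterInEvent ends t {W : Set V | o ∈ W} ∩
          (connEvent ends s t)ᶜ) +
              prob (Function.update p f 1) (connEvent ends s u ∩ clusterInEvent ends s {W : Set V | o ∈ W} ∩
          (connEvent ends s t)ᶜ)) -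
          prob (Function.update p f 1) (connEvent ends s u ∩ (connEvent ends s t)ᶜ) *
            prob (Function.update p f 1) (clusterInEvent ends s {W : Set V | o ∈ W} ∩ (connEvent ends s t)ᶜ)) -
      prob (Function.update p f 1) (clusterInEvent ends s 𝓤 ∩ clusterInEvent ends t {W : Set V | o ∈ W} ∩
          (connEvent ends s t)ᶜ) * prob (Function.update p f 1) (connEvent ends s t)ᶜ * prob (Function.update p f 1) (connEvent ends s t)ᶜ) ≤ (prob p (clusterInEvent ends s 𝓤 ∩ (connEvent ends s t)ᶜ) *
        ((prob p (connEvent ends s t)ᶜ - prob p (connEvent ends s u ∩ (connEvent ends s t)ᶜ)) *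
            prob p (clusterInEvent ends t {W : Set V | o ∈ W} ∩ (connEvent ends s t)ᶜ) +
          prob p (connEvent ends s t)ᶜ *
            (prob p (connEvent ends s u ∩ clusterInEvent ends t {W : Set V | o ∈ W} ∩
          (connEvent ends s t)ᶜ) +
              prob p (connEvent ends s u ∩ clusterInEvent ends s {W : Set V | o ∈ W} ∩
          (connEvent ends s t)ᶜ)) -
          prob p (connEvent ends s u ∩ (connEvent ends s t)ᶜ) *
            prob p (clusterInEvent ends s {W : Set V | o ∈ W} ∩ (connEvent ends s t)ᶜ)) -
      prob p (clusterInEvent ends s 𝓤 ∩ clusterInEvent ends t {W : Set V | o ∈ W} ∩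
          (connEvent ends s t)ᶜ) * prob p (connEvent ends s t)ᶜ * prob p (connEvent ends s t)ᶜ)) :
    ∀ p : E → R, IsProbVec p → 0 ≤ (prob p (clusterInEvent ends s 𝓤 ∩ (connEvent ends s t)ᶜ) *
        ((prob p (connEvent ends s t)ᶜ - prob p (connEvent ends s u ∩ (connEvent ends s t)ᶜ)) *
            prob p (clusterInEvent ends t {W : Set V | o ∈ W} ∩ (connEvent ends s t)ᶜ) +
          prob p (connEvent ends s t)ᶜ *
            (prob p (connEvent ends s u ∩ clusterInEvent ends t {W : Set V | o ∈ W} ∩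
          (connEvent ends s t)ᶜ) +
              prob p (connEvent ends s u ∩ clusterInEvent ends s {W : Set V | o ∈ W} ∩
          (connEvent ends s t)ᶜ)) -
          prob p (connEvent ends s u ∩ (connEvent ends s t)ᶜ) *
            prob p (clusterInEvent ends s {W : Set V | o ∈ W} ∩ (connEvent ends s t)ᶜ)) -
      prob p (clusterInEvent ends s 𝓤 ∩ clusterInEvent ends t {W : Set V | o ∈ W} ∩
          (connEvent ends s t)ᶜ) * prob p (connEvent ends s t)ᶜ * prob p (connEvent ends s t)ᶜ) := by
  refine psi_slack_nonneg_of_uni ends s t o u 𝓤 fun p hp hex => ?_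
  by_cases hT : ∃ e, (∃ y ∈ ends e, Conn ends (fun e => decide (p e = 1)) t y) ∧
      p e ≠ 0 ∧ p e ≠ 1
  · obtain ⟨f, _, hf0, hf1, hmin⟩ := huni p hp hT
    exact ⟨f, hf0, hf1, hmin⟩
  · obtain ⟨e, he0, he1⟩ := hex
    have hpin : ∀ e, (∃ y ∈ ends e, Conn ends (fun e => decide (p e = 1)) t y) →
        p e = 0 ∨ p e = 1 := by
      intro e hy
      by_contra hne
      exact hT ⟨e, hy, fun h => hne (Or.inl h), fun h => hne (Or.inr h)⟩
    exact ⟨e, he0, he1, psi_uni_of_explored p hp ends s t o u hpin 𝓤 e⟩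

end Frame

end Summit.Ventures.PercRepro2
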